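import Summits.Ventures.Crystal3D.Theorems.StickyWulffConstantGenericWallFloorStackWalkReverse
import HarnessLib

/-!
# TERRACE EDGES of an exact twin cap: the six in-plane neighbours of a cap are occupied, never frame-full, and a cap
# among them has the SAME normal (crux `GenericWallFloor`, stmt-Ventures-19480, line `WallLedgerG`)

HONEST FRAMING. Venture `Summits/Ventures/Crystal3D` (cell `crystal3d-full`), helper `--supports` the crux
`GenericWallFloor` of `route-Ventures-StickyWulffConstant`, REGISTERED line `WallLedgerG`, open stub
`stub_twoSlabAdhesion`.  Rung credit + structure only; F-C1 not moved; NOT the crux.  CENSUS-FREE (slot algebra only).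

WHY.  On the ARRIVAL class of the ray-aligned core (`GenericWallFloorArrivalResidual`, `…InPlaneTwinOnly`) one grain's
steep walkers PUSH through the coherent terraces of a twin interface (exact oriented caps, `IsOrientedCap`) and arrive in
the far lattice without paying; the cost of the interface sits at the terrace EDGES (risers).  This file is the local
structure theorem of a terrace edge seen from the cap side — the raw material of any «lamella-side rooting» (ROUTE.md
§85 R41w) and of the cap-level rigidity «adjacent arriving lines cap at the same level»:

* `exists_pos_pair_of_inPlane` — an in-plane slot `w′` of the cap normal `n` (`⟪F w′, n⟫ = 0`) is a difference `a − b`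
  of two `n`-POSITIVE slots (`inPlane_eq_sub_of_nearPolar` for `−n`);
* **`not_full_inPlane_neighbour_of_cap`** — if `c` is an exact oriented cap of the frame `F` with normal `n`, then NO
  in-plane neighbour `c + F w′` is `F`-full: its slot `(c + F w′) + F b = c + F a` is an empty positive slot of the cap.
  (The in-plane neighbours themselves are OCCUPIED — part of `IsOrientedCap`.)  Hence a walker of frame `F` standing on
  an in-plane neighbour of a cap does not make a FULL step there (`walkStep_inPlane_neighbour`);
* **`cap_normal_eq_of_inPlane_neighbour`** — if an in-plane neighbour `c + F w′` of the `n`-cap `c` is itself an exact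
  oriented cap of `F` (any direction, any unit menu normal `n′`), then `n′ = n`: the empty slot `b` and the slot `a`
  (`c` is occupied) are both `n′`-positive, and two common positive slots pin the normal
  (`menu_normal_eq_or_eq_twin` + `inner_eq_half_of_pos_pos`);
* **`inPlane_neighbour_dichotomy`** — so at an in-plane neighbour of an `n`-cap a frame-`F` walker either STOPS (the ball
  is unsaturated by `ExactOnly` downstream: it PAYS) or meets an `n`-cap again (the terrace continues): terraces of
  exact caps propagate their normal along the composition plane until a paying edge.
CONSEQUENCE (informal, for R41w): along a family of parallel steep lines of one frame, two ADJACENT lines (in-plane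
offset) whose walkers both push through `n`-caps do so at the SAME `n`-level — a line adjacent to a cap at level `λ`
cannot be full at level `λ`; level jumps of the cap surface (risers, however tall) are separated by lines whose walker
stops at or below the lower level.  Memo ARRIVING-FAMILY-g6 (evidence on the item).
WHAT THIS IS NOT: not the stub; no ledger; no claim about riser cost per unit height; F-C1 not moved.
-/

noncomputable section

namespace Summit.Ventures.Crystal3D.Theorems

open Summit.Ventures.Crystal3D Finset
open Literature.MathematicalPhysics.StatisticalMechanics (fccStacking)
open scoped InnerProductSpace

variable {X : Finset (EuclideanSpace ℝ (Fin 3))}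

/-! ### Slot algebra: in-plane slots are differences of positive slots -/

/-- **An in-plane slot is a difference of two POSITIVE slots.**  For a unit menu normal `n` of `F` and a slot `w′` with
`⟪F w′, n⟫ = 0` there are slots `a ≠ b`, both `n`-positive (`⟪F a, n⟫ = ⟪F b, n⟫ = √(2/3)`), with `w′ = a − b`. -/
theorem exists_pos_pair_of_inPlane (F : EuclideanSpace ℝ (Fin 3) ≃ₗᵢ[ℝ] EuclideanSpace ℝ (Fin 3))
    {n w' : EuclideanSpace ℝ (Fin 3)} (hn : ‖n‖ = 1)
    (hmenu : ∀ w ∈ fccSlots, ⟪F w, n⟫_ℝ = 0 ∨ ⟪F w, n⟫_ℝ = Real.sqrt (2 / 3) ∨ ⟪F w, n⟫_ℝ = -Real.sqrt (2 / 3))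
    (hw' : w' ∈ fccSlots) (hw'n : ⟪F w', n⟫_ℝ = 0) :
    ∃ a ∈ fccSlots, ∃ b ∈ fccSlots, a ≠ b ∧ ⟪F a, n⟫_ℝ = Real.sqrt (2 / 3) ∧ ⟪F b, n⟫_ℝ = Real.sqrt (2 / 3) ∧
      w' = a - b := by
  classical
  have hmn : ‖-n‖ = 1 := by rw [norm_neg, hn]
  have hmenu' : ∀ w ∈ fccSlots, ⟪F w, -n⟫_ℝ = 0 ∨ ⟪F w, -n⟫_ℝ = Real.sqrt (2 / 3) ∨ ⟪F w, -n⟫_ℝ = -Real.sqrt (2 / 3) := by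
    intro w hw
    rw [inner_neg_right]
    rcases hmenu w hw with h | h | h
    · exact Or.inl (by rw [h, neg_zero])
    · exact Or.inr (Or.inr (by rw [h]))
    · exact Or.inr (Or.inl (by rw [h, neg_neg]))
  -- the three `n`-positive slots are the near-polar slots of `−n`
  obtain ⟨w₁, hw₁, w₂, hw₂, w₃, hw₃, h12, h13, h23, hn₁, hn₂, hn₃⟩ := exists_three_far_slots F hn hmenu
  have hm : ∀ {w}, ⟪F w, n⟫_ℝ = Real.sqrt (2 / 3) → ⟪F w, -n⟫_ℝ = -Real.sqrt (2 / 3) := fun h => by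
    rw [inner_neg_right, h]
  obtain ⟨a, ha, b, hb, hab⟩ := inPlane_eq_sub_of_nearPolar F hmn hmenu' hw' (by rw [inner_neg_right, hw'n, neg_zero])
    hw₁ hw₂ hw₃ h12 h13 h23 (hm hn₁) (hm hn₂) (hm hn₃)
  simp only [Finset.mem_insert, Finset.mem_singleton] at ha hb
  have haslot : a ∈ fccSlots := by rcases ha with rfl | rfl | rfl <;> assumption
  have hbslot : b ∈ fccSlots := by rcases hb with rfl | rfl | rfl <;> assumption
  have han : ⟪F a, n⟫_ℝ = Real.sqrt (2 / 3) := by rcases ha with rfl | rfl | rfl <;> assumption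
  have hbn : ⟪F b, n⟫_ℝ = Real.sqrt (2 / 3) := by rcases hb with rfl | rfl | rfl <;> assumption
  refine ⟨a, haslot, b, hbslot, ?_, han, hbn, hab⟩
  rintro rfl
  have h1 := norm_eq_one_of_mem_fccSlots hw'
  rw [hab, sub_self, norm_zero] at h1
  exact zero_ne_one h1

/-! ### The in-plane neighbours of a cap -/

/-- The in-plane neighbours of an exact oriented cap are occupied (part of the cap). -/
theorem inPlane_neighbour_mem_of_cap {F : EuclideanSpace ℝ (Fin 3) ≃ₗᵢ[ℝ] EuclideanSpace ℝ (Fin 3)}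
    {c v n w' : EuclideanSpace ℝ (Fin 3)} (hcap : IsOrientedCap X F c v n) (hw' : w' ∈ fccSlots)
    (hw'n : ⟪F w', n⟫_ℝ = 0) : c + F w' ∈ X :=
  hcap.2.2.2.1 w' hw' (le_of_eq hw'n)

/-- **No in-plane neighbour of a cap is frame-full.**  If `c` is an exact oriented cap of `F` with normal `n` and
`⟪F w′, n⟫ = 0`, then some `F`-slot of `c + F w′` is empty — namely `(c + F w′) + F b = c + F a` for the positive pair
`w′ = a − b`. -/
theorem not_full_inPlane_neighbour_of_cap {F : EuclideanSpace ℝ (Fin 3) ≃ₗᵢ[ℝ] EuclideanSpace ℝ (Fin 3)}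
    {c v n w' : EuclideanSpace ℝ (Fin 3)} (hcap : IsOrientedCap X F c v n) (hw' : w' ∈ fccSlots)
    (hw'n : ⟪F w', n⟫_ℝ = 0) : ¬ ∀ w ∈ fccSlots, c + F w' + F w ∈ X := by
  obtain ⟨hn, hmenu, -, -, hpos⟩ := hcap
  obtain ⟨a, ha, b, hb, -, han, -, hab⟩ := exists_pos_pair_of_inPlane F hn hmenu hw' hw'n
  intro hfull
  have hrpos : 0 < Real.sqrt (2 / 3) := Real.sqrt_pos.2 (by norm_num)
  have hempty : c + F a ∉ X := (hpos a ha (by rw [han]; exact hrpos)).1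
  have h := hfull b hb
  rw [hab, map_sub, add_assoc, sub_add_cancel] at h
  exact hempty h

/-! ### A cap next to a cap has the same normal -/

/-- Two distinct slots positive for two unit menu normals of the same frame force the normals to agree. -/
theorem normal_eq_of_two_pos {F : EuclideanSpace ℝ (Fin 3) ≃ₗᵢ[ℝ] EuclideanSpace ℝ (Fin 3)}
    {n n' a b : EuclideanSpace ℝ (Fin 3)} (hn : ‖n‖ = 1) (hn' : ‖n'‖ = 1)
    (hmenu : ∀ w ∈ fccSlots, ⟪F w, n⟫_ℝ = 0 ∨ ⟪F w, n⟫_ℝ = Real.sqrt (2 / 3) ∨ ⟪F w, n⟫_ℝ = -Real.sqrt (2 / 3))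
    (hmenu' : ∀ w ∈ fccSlots, ⟪F w, n'⟫_ℝ = 0 ∨ ⟪F w, n'⟫_ℝ = Real.sqrt (2 / 3) ∨ ⟪F w, n'⟫_ℝ = -Real.sqrt (2 / 3))
    (ha : a ∈ fccSlots) (hb : b ∈ fccSlots) (hab : a ≠ b)
    (han : ⟪F a, n⟫_ℝ = Real.sqrt (2 / 3)) (hbn : ⟪F b, n⟫_ℝ = Real.sqrt (2 / 3))
    (han' : ⟪F a, n'⟫_ℝ = Real.sqrt (2 / 3)) (hbn' : ⟪F b, n'⟫_ℝ = Real.sqrt (2 / 3)) : n' = n := by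
  have hrpos : 0 < Real.sqrt (2 / 3) := Real.sqrt_pos.2 (by norm_num)
  obtain ⟨h23, -⟩ := sqrt_twoThirds_facts
  have hFa : ‖F a‖ = 1 := by rw [LinearIsometryEquiv.norm_map, norm_eq_one_of_mem_fccSlots ha]
  rcases menu_normal_eq_or_eq_twin F hn hn' hFa hmenu hmenu' han han' with h | h
  · exact h
  · exfalso
    have hab' : ⟪a, b⟫_ℝ = 1 / 2 :=
      inner_eq_half_of_pos_pos F hn hmenu ha hb hab (by rw [han]; exact hrpos) (by rw [hbn]; exact hrpos)
    have h0 : ⟪F b, n'⟫_ℝ = 0 := by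
      rw [h, inner_sub_right, real_inner_smul_right, LinearIsometryEquiv.inner_map_map, real_inner_comm a b, hab', hbn]
      ring
    rw [h0] at hbn'
    exact (ne_of_gt hrpos) hbn'.symm

/-- **A cap next to a cap has the same normal.**  If the ball `c ∈ X` is an exact oriented cap of `F` with normal `n`,
`w′` an in-plane slot, and the neighbour `c + F w′` is an exact oriented cap of `F` for some direction `v′` and unit
menu normal `n′`, then `n′ = n`. -/
theorem cap_normal_eq_of_inPlane_neighbour {F : EuclideanSpace ℝ (Fin 3) ≃ₗᵢ[ℝ] EuclideanSpace ℝ (Fin 3)}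
    {c v n w' v' n' : EuclideanSpace ℝ (Fin 3)} (hc : c ∈ X) (hcap : IsOrientedCap X F c v n) (hw' : w' ∈ fccSlots)
    (hw'n : ⟪F w', n⟫_ℝ = 0) (hcap' : IsOrientedCap X F (c + F w') v' n') : n' = n := by
  obtain ⟨hn, hmenu, -, -, hpos⟩ := hcap
  obtain ⟨hn', hmenu', -, hnonpos', hpos'⟩ := hcap'
  have hrpos : 0 < Real.sqrt (2 / 3) := Real.sqrt_pos.2 (by norm_num)
  obtain ⟨a, ha, b, hb, hab, han, hbn, hw'ab⟩ := exists_pos_pair_of_inPlane F hn hmenu hw' hw'n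
  -- `b` is `n′`-positive: the slot `(c + F w′) + F b = c + F a` is an empty positive slot of the first cap
  have hca : c + F a ∉ X := (hpos a ha (by rw [han]; exact hrpos)).1
  have hb_pos : 0 < ⟪F b, n'⟫_ℝ := by
    by_contra hle
    push Not at hle
    have h := hnonpos' b hb hle
    rw [hw'ab, map_sub, add_assoc, sub_add_cancel] at h
    exact hca h
  -- `−w′ = b − a` is not `n′`-positive: `(c + F w′) + F(−w′) = c` is occupied
  have hmw' : -w' ∈ fccSlots := neg_mem_fccSlots hw'
  have hw_nonpos : ⟪F (-w'), n'⟫_ℝ ≤ 0 := by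
    by_contra hlt
    push Not at hlt
    have h := (hpos' (-w') hmw' hlt).1
    rw [map_neg, add_neg_cancel_right] at h
    exact h hc
  -- hence `a` is `n′`-positive too
  have hbn' : ⟪F b, n'⟫_ℝ = Real.sqrt (2 / 3) := by
    rcases hmenu' b hb with h | h | h
    · rw [h] at hb_pos; exact absurd hb_pos (lt_irrefl 0)
    · exact h
    · rw [h] at hb_pos; linarith
  have han' : ⟪F a, n'⟫_ℝ = Real.sqrt (2 / 3) := by
    have h1 : ⟪F (-w'), n'⟫_ℝ = ⟪F b, n'⟫_ℝ - ⟪F a, n'⟫_ℝ := by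
      rw [hw'ab, neg_sub, map_sub, inner_sub_left]
    rw [h1, hbn'] at hw_nonpos
    rcases hmenu' a ha with h | h | h
    · rw [h] at hw_nonpos; linarith
    · exact h
    · rw [h] at hw_nonpos; linarith
  exact normal_eq_of_two_pos hn hn' hmenu hmenu' ha hb hab han hbn han' hbn'

/-- **The terrace-edge dichotomy.**  At an in-plane neighbour `c + F w′` of an exact oriented `n`-cap `c ∈ X` of the frame
`F`: the ball is occupied, it is NOT `F`-full, and if it is an exact oriented cap of `F` at all (any direction, any unit
menu normal) then its normal is `n` again.  In walk terms: a frame-`F` walker standing there STOPS (and pays, downstream)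
unless the `n`-terrace continues under it. -/
theorem inPlane_neighbour_dichotomy {F : EuclideanSpace ℝ (Fin 3) ≃ₗᵢ[ℝ] EuclideanSpace ℝ (Fin 3)}
    {c v n w' : EuclideanSpace ℝ (Fin 3)} (hc : c ∈ X) (hcap : IsOrientedCap X F c v n) (hw' : w' ∈ fccSlots)
    (hw'n : ⟪F w', n⟫_ℝ = 0) :
    c + F w' ∈ X ∧ (¬ ∀ w ∈ fccSlots, c + F w' + F w ∈ X) ∧
      ∀ (v' n' : EuclideanSpace ℝ (Fin 3)), IsOrientedCap X F (c + F w') v' n' → n' = n :=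
  ⟨inPlane_neighbour_mem_of_cap hcap hw' hw'n, not_full_inPlane_neighbour_of_cap hcap hw' hw'n,
    fun _ _ hcap' => cap_normal_eq_of_inPlane_neighbour hc hcap hw' hw'n hcap'⟩

/-- **Walk form of the dichotomy.**  For a walker state `(c + F w′, e :: rest)` with top frame `e.frame = F`: the step is
NOT the full move; it is a stop, or a cap move whose normal is the terrace normal `n`. -/
theorem walkStep_inPlane_neighbour {F : EuclideanSpace ℝ (Fin 3) ≃ₗᵢ[ℝ] EuclideanSpace ℝ (Fin 3)}
    {c v n w' : EuclideanSpace ℝ (Fin 3)} (hc : c ∈ X) (hcap : IsOrientedCap X F c v n) (hw' : w' ∈ fccSlots)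
    (hw'n : ⟪F w', n⟫_ℝ = 0) (z : EuclideanSpace ℝ (Fin 3)) {e : WalkEntry} (he : e.frame = F)
    (rest : List WalkEntry) :
    walkStep X z (c + F w', e :: rest) = none ∨
      ∃ h : ∃ n', IsOrientedCap X e.frame (c + F w') e.dir n',
        Classical.choose h = n ∧ walkStep X z (c + F w', e :: rest) = some (capMove z (c + F w') e rest n) := by
  classical
  subst he
  obtain ⟨-, hnf, hnorm⟩ := inPlane_neighbour_dichotomy hc hcap hw' hw'n
  by_cases hcp : ∃ n', IsOrientedCap X e.frame (c + e.frame w') e.dir n'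
  · right
    have hn' : Classical.choose hcp = n := hnorm e.dir _ (Classical.choose_spec hcp)
    refine ⟨hcp, hn', ?_⟩
    rw [walkStep_of_cap X z _ e rest hnf hcp, hn']
  · left
    exact walkStep_of_stop X z _ e rest hnf hcp

end Summit.Ventures.Crystal3D.Theorems

end
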